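import Mathlib

/-!
# Dual certificate law for the pad-4 residual families (plan-lens-HodgeAV-dual g0, R19.171 forest move E1 «dual»)

HONEST FRAMING. Nothing in this file is proved toward HC / HC_CM / HC_AV / №4 / 26512 / 18881 / H2.  It types, sorry-free and
over Mathlib only, the *polytope-level law* behind the certificates of record (LINE-12 three words; BAND-2 `F₊ ∕ F₋ ∕ F_Im`;
BAND-4 `F₊ ∕ F₋` only) read as ONE family in the line height `h` and the band width `b`:

* `reI`, `eps`, `cS`, `collinearB`, `evenB` and `typeTable` — the finite phase law behind the row `Re⟨eeēē⟩`: for a fully charged cell with phases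
  `k : Fin 4 → ZMod 4` (β_j = r_j · i^{k_j}), the column value of `Re⟨eeēē⟩` is `sg·|O|·V·cS(k)/3` and `Re μ = sg·|O|·V·eps(k)`;
  the table says `cS = 3·eps` on collinear types (all phases of one parity), `cS = -eps` on the even non-collinear types
  `T₂ = {(0011),(0013),(0123)}`, and `eps = cS = 0` on odd types (256 cases, `decide`).
* `lawR` — consequence for every clean design `m` (clean against the single class row `Re⟨eeēē⟩`):
  `Σ m·Re μ = (4/3) · Σ_{T₂ columns} m·Re μ`; `lawR_noT2` — if no `T₂` column carries mass, `Re μ(m) = 0`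
  (this is the Re-half of LINE-12 / BAND-2 / BAND-4: there the census of record has no static `T₂` orbit at all).
* `oneSided` — the deadness mechanism behind `F_Im = Re⟨eeēē⟩ + Q` (`Q = 2⟨1uup⟩ − ⟨uuuu⟩ − ⟨11pp⟩`): on a survivor set whose
  padding is `Q`-null, cleanness against the class functional `−(Re⟨eeēē⟩ + Q)` reads `Σ_N w·m = Σ_P w·m` with
  `w = (1 − c_τ/6)·V·|O| ≥ 0` on fully charged columns (zero exactly on the balanced types `(0000),(0022)`, `= V|O|` on odd types)
  and `0` elsewhere; no positive weight on the N level then kills every weighted P column — in particular every odd (Im-carrying) one.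
  CHARACTERISATION (see the memo): `F_Im ≥ |Im μ|` columnwise on `K` iff (a) N-level non-FC columns have `q ≥ 0` and P-level ones
  `q ≤ 0` (Q-null padding suffices) and (b) every N-level FC orbit of `K` has type `(0000)` or `(0022)` — true for LINE-12 and BAND-2@12,
  false for BAND-4@12 (mixed-top padding with `q > 0` at P, and one static N-`(0002)` orbit) and for LINE-14/16 (static odd N orbits).
* `q_closed_form`, `q_line` — the t-free word `Q = 2⟨1uup⟩ − ⟨uuuu⟩ − ⟨11pp⟩` has the closed form
  `−(1/12)·Σ_{splits} g_ij g_kl`, `g_ij = (α_i − α_j)² − n_i − n_j` (`n = |β|²`), and on a single-line cell (`α_j + r_j = t`, `n_j = r_j²`)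
  it equals `−r₁r₂r₃r₄ = −V`: `Q` is the universal t-free form of the static mass law on line cells.

Evidence files (same folder / crux dir): `DUAL-CERT-FAMILY-g0.md` (tables per family, LP values, the LINE-14 `Re μ ≡ 0` class⊗static search,
the BAND-4 / LINE-14 `Im` witnesses, the LINE-16 hand-over).  Seats produce evidence and typed files, not rungs.
-/

namespace Summit.HodgeConjecture.HodgeConjecture.Cruxes.BlochSeedDiscOne.DualLaw

/-! ## 1. The finite phase law behind the row `Re⟨eeēē⟩` -/

/-- `Re (i^n)` for `n : ZMod 4`. -/
def reI (n : ZMod 4) : ℤ := if n = 0 then 1 else if n = 2 then -1 else 0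

/-- `Im (i^n)` for `n : ZMod 4`. -/
def imI (n : ZMod 4) : ℤ := if n = 1 then 1 else if n = 3 then -1 else 0

/-- phase factor of `μ = ⟨eeee⟩` on a fully charged cell with phases `k`: `Re μ ∝ eps k`. -/
def eps (k : Fin 4 → ZMod 4) : ℤ := reI (k 0 + k 1 + k 2 + k 3)

/-- phase factor of `Im μ`. -/
def iota (k : Fin 4 → ZMod 4) : ℤ := imI (k 0 + k 1 + k 2 + k 3)

/-- phase factor of the row `Re⟨eeēē⟩`: sum over the three `2+2` splits of `Re i^{k_i+k_j-k_k-k_l}`. -/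
def cS (k : Fin 4 → ZMod 4) : ℤ :=
  reI (k 0 + k 1 - k 2 - k 3) + reI (k 0 + k 2 - k 1 - k 3) + reI (k 0 + k 3 - k 1 - k 2)

/-- collinear phase type (as a `Bool`): all four phases have the same parity (types `(0000),(0022),(0002)` and their odd rotations). -/
def collinearB (k : Fin 4 → ZMod 4) : Bool :=
  decide (2 * k 1 = 2 * k 0 ∧ 2 * k 2 = 2 * k 0 ∧ 2 * k 3 = 2 * k 0)

/-- even phase type (as a `Bool`): `Σ k` even (then `μ` is real up to the common factor); odd types carry `Im μ` only. -/
def evenB (k : Fin 4 → ZMod 4) : Bool :=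
  decide (2 * (k 0 + k 1 + k 2 + k 3) = 0)

/-- THE TYPE TABLE (256 cases, stated on explicit phase vectors `![a,b,c,d]`). Collinear ⇒ `cS = 3·eps`;
even non-collinear (`T₂`) ⇒ `cS = -eps` and `eps ≠ 0`; odd ⇒ `eps = 0` and `cS = 0`; even ⇒ `iota = 0`. -/
theorem typeTable : ∀ a b c d : ZMod 4,
    (collinearB ![a, b, c, d] = true → cS ![a, b, c, d] = 3 * eps ![a, b, c, d]) ∧
    (evenB ![a, b, c, d] = true → collinearB ![a, b, c, d] = false →
        cS ![a, b, c, d] = - eps ![a, b, c, d] ∧ eps ![a, b, c, d] ≠ 0) ∧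
    (evenB ![a, b, c, d] = false → eps ![a, b, c, d] = 0 ∧ cS ![a, b, c, d] = 0) ∧
    (evenB ![a, b, c, d] = true → iota ![a, b, c, d] = 0) := by
  unfold collinearB evenB cS eps iota reI imI
  simp only [Fin.isValue, Matrix.cons_val_zero]
  decide

/-! ## 2. Law R: on clean designs `Re μ` lives on the `T₂` columns only -/

section lawR
variable {ι : Type*} [DecidableEq ι]

/-- Law R. Columns `K`; `T6` = collinear-even FC columns, `T2` = non-collinear-even FC columns (disjoint); on every other column both the
row value `S` (= `Re⟨eeēē⟩`) and `Re μ` vanish (odd FC columns and non-FC columns); `T6 ∩ T2` is harmless (there `Re μ = 0` is forced).  Column facts: `S = Re μ` on `T6`, `S = -Re μ/3` on `T2`.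
Cleanness of the design `m` against the single row `S` forces `Σ m·Re μ = (4/3)·Σ_{T2} m·Re μ`. -/
theorem lawR (K T6 T2 : Finset ι) (reμ S m : ι → ℚ)
    (h6 : ∀ k ∈ K, k ∈ T6 → S k = reμ k)
    (h2 : ∀ k ∈ K, k ∈ T2 → S k = - reμ k / 3)
    (h0 : ∀ k ∈ K, k ∉ T6 → k ∉ T2 → S k = 0 ∧ reμ k = 0)
    (hclean : ∑ k ∈ K, m k * S k = 0) :
    ∑ k ∈ K, m k * reμ k = (4 / 3) * ∑ k ∈ K.filter (· ∈ T2), m k * reμ k := by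
  -- split both sums along T6 / T2 / rest
  have key : ∀ k ∈ K, m k * reμ k = (4 / 3) * (if k ∈ T2 then m k * reμ k else 0) + m k * S k := by
    intro k hk
    by_cases hk2 : k ∈ T2
    · have hS := h2 k hk hk2
      simp [hk2, hS]; ring
    · by_cases hk6 : k ∈ T6
      · have hS := h6 k hk hk6
        simp [hk2, hS]
      · obtain ⟨hS, hr⟩ := h0 k hk hk6 hk2
        simp [hk2, hS, hr]
  calc ∑ k ∈ K, m k * reμ k
      = ∑ k ∈ K, ((4 / 3) * (if k ∈ T2 then m k * reμ k else 0) + m k * S k) := Finset.sum_congr rfl key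
    _ = (4 / 3) * ∑ k ∈ K, (if k ∈ T2 then m k * reμ k else 0) + ∑ k ∈ K, m k * S k := by
        rw [Finset.sum_add_distrib, Finset.mul_sum]
    _ = (4 / 3) * ∑ k ∈ K.filter (· ∈ T2), m k * reμ k := by
        rw [hclean, add_zero, Finset.sum_filter]

/-- Corollary (the Re-half at `h = 12`: LINE-12, BAND-2, BAND-4 of record): if no `T₂` column carries mass — e.g. because no `T₂` orbit is
static (census of record) — then every clean design has `Re μ = 0`, whatever the levels/signs and the padding. -/
theorem lawR_noT2 (K T6 T2 : Finset ι) (reμ S m : ι → ℚ)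
    (h6 : ∀ k ∈ K, k ∈ T6 → S k = reμ k)
    (h2 : ∀ k ∈ K, k ∈ T2 → S k = - reμ k / 3)
    (h0 : ∀ k ∈ K, k ∉ T6 → k ∉ T2 → S k = 0 ∧ reμ k = 0)
    (hclean : ∑ k ∈ K, m k * S k = 0)
    (hnoT2 : ∀ k ∈ K, k ∈ T2 → m k = 0) :
    ∑ k ∈ K, m k * reμ k = 0 := by
  rw [lawR K T6 T2 reμ S m h6 h2 h0 hclean]
  have : ∑ k ∈ K.filter (· ∈ T2), m k * reμ k = 0 := by
    apply Finset.sum_eq_zero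
    intro k hk
    rw [Finset.mem_filter] at hk
    simp [hnoT2 k hk.1 hk.2]
  rw [this]; norm_num

/-- Sign corollary (LINE-14 of record: the only static `T₂` orbits are positive carriers): if every massive `T₂` column has `Re μ_k ≥ 0`
then `Re μ(m) ≥ 0` for every clean nonnegative design. -/
theorem lawR_sign (K T6 T2 : Finset ι) (reμ S m : ι → ℚ)
    (h6 : ∀ k ∈ K, k ∈ T6 → S k = reμ k)
    (h2 : ∀ k ∈ K, k ∈ T2 → S k = - reμ k / 3)
    (h0 : ∀ k ∈ K, k ∉ T6 → k ∉ T2 → S k = 0 ∧ reμ k = 0)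
    (hclean : ∑ k ∈ K, m k * S k = 0)
    (hm : ∀ k ∈ K, 0 ≤ m k)
    (hpos : ∀ k ∈ K, k ∈ T2 → 0 < m k → 0 ≤ reμ k) :
    0 ≤ ∑ k ∈ K, m k * reμ k := by
  rw [lawR K T6 T2 reμ S m h6 h2 h0 hclean]
  apply mul_nonneg (by norm_num)
  apply Finset.sum_nonneg
  intro k hk
  rw [Finset.mem_filter] at hk
  rcases (hm k hk.1).lt_or_eq with hlt | heq
  · exact mul_nonneg (hm k hk.1) (hpos k hk.1 hk.2 hlt)
  · rw [← heq]; simp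

end lawR

/-! ## 3. The one-sided deadness mechanism (why `F_Im` exists for LINE-12 / BAND-2 and not for BAND-4) -/

section oneSided
variable {ι : Type*}

/-- One-sided deadness. A valid balance functional `Σ_{N} w·m = Σ_{P} w·m` with nonnegative weights (the class functional
`−(Re⟨eeēē⟩ + Q) = −F_Im` on a `Q`-null-padded survivor set has `w = (1 − c_τ/6)·V·|O| ≥ 0` on FC columns, zero exactly on the balanced
types `(0000),(0022)`, and `0` on the padding): if the N level carries no positive weight, every positively weighted P column is
massless (and symmetrically). -/
theorem oneSided (KN KP : Finset ι) (w m : ι → ℚ)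
    (hw : ∀ k ∈ KP, 0 ≤ w k) (hm : ∀ k ∈ KP, 0 ≤ m k)
    (hbal : ∑ k ∈ KN, w k * m k = ∑ k ∈ KP, w k * m k)
    (hN : ∀ k ∈ KN, w k * m k = 0) :
    ∀ k ∈ KP, 0 < w k → m k = 0 := by
  have hzero : ∑ k ∈ KP, w k * m k = 0 := by
    rw [← hbal]; exact Finset.sum_eq_zero hN
  have hall := (Finset.sum_eq_zero_iff_of_nonneg (fun k hk => mul_nonneg (hw k hk) (hm k hk))).1 hzero
  intro k hk hwk
  have := hall k hk
  rcases mul_eq_zero.1 this with h | h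
  · exact absurd h (ne_of_gt hwk)
  · exact h

/-- The `Im` consequence: `Im μ(m) = Σ_{odd columns} ι·m` vanishes once every odd column is massless (odd types have weight
`V·|O| > 0` in the functional above, so `oneSided` applies when the N level has balanced FC types only and the padding is `Q`-null). -/
theorem im_dead_of_odd_massless (K Odd : Finset ι) (imμ m : ι → ℚ)
    (h0 : ∀ k ∈ K, k ∉ Odd → imμ k = 0) (hodd : ∀ k ∈ K, k ∈ Odd → m k = 0) :
    ∑ k ∈ K, m k * imμ k = 0 := by
  apply Finset.sum_eq_zero
  intro k hk
  by_cases h : k ∈ Odd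
  · simp [hodd k hk h]
  · simp [h0 k hk h]

end oneSided

/-! ## 4. The t-free word `Q = 2⟨1uup⟩ − ⟨uuuu⟩ − ⟨11pp⟩`: closed form and the line law -/

section Q
variable {R : Type*} [CommRing R]

/-- placement sum of the word `1uup` over `S₄` (each unordered `{u_i,u_j}` with `p_k`, `k ∉ {i,j}`, counted twice). -/
def P1uup (u p : Fin 4 → R) : R :=
  2 * (p 0 * (u 1 * u 2 + u 1 * u 3 + u 2 * u 3) + p 1 * (u 0 * u 2 + u 0 * u 3 + u 2 * u 3)
     + p 2 * (u 0 * u 1 + u 0 * u 3 + u 1 * u 3) + p 3 * (u 0 * u 1 + u 0 * u 2 + u 1 * u 2))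

/-- placement sum of `uuuu` over `S₄`. -/
def Puuuu (u : Fin 4 → R) : R := 24 * (u 0 * u 1 * u 2 * u 3)

/-- placement sum of `11pp` over `S₄` (each unordered pair counted four times). -/
def P11pp (p : Fin 4 → R) : R :=
  4 * (p 0 * p 1 + p 0 * p 2 + p 0 * p 3 + p 1 * p 2 + p 1 * p 3 + p 2 * p 3)

/-- `q` of a cell `(α_j, n_j = |β_j|²)`: `(1/24)·(2·P1uup − Puuuu − P11pp)` with `u = α`, `p = α² − n`; we state `24·q`. -/
def q24 (α n : Fin 4 → R) : R :=
  2 * P1uup α (fun j => α j ^ 2 - n j) - Puuuu α - P11pp (fun j => α j ^ 2 - n j)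

/-- split defect `g_ij = (α_i − α_j)² − n_i − n_j`. -/
def g (α n : Fin 4 → R) (i j : Fin 4) : R := (α i - α j) ^ 2 - n i - n j

/-- CLOSED FORM: `24·q = −2·Σ_{splits ij|kl} g_ij·g_kl`, i.e. `q = −(1/12)·Σ_{splits} g_ij g_kl`. -/
theorem q_closed_form (α n : Fin 4 → R) :
    q24 α n = -2 * (g α n 0 1 * g α n 2 3 + g α n 0 2 * g α n 1 3 + g α n 0 3 * g α n 1 2) := by
  unfold q24 P1uup Puuuu P11pp g
  ring

/-- LINE LAW: on a single-line cell (`α_j = t − r_j`, `n_j = r_j²`, all tops equal to `t`) `q = −r₀r₁r₂r₃ = −V`: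
`Q = sg·|O|·q` is `t`-free and equals minus the charged volume — the universal form of the static mass law on line cells,
and `0` as soon as one letter is uncharged (`r_j = 0`). -/
theorem q_line (t : R) (r : Fin 4 → R) :
    q24 (fun j => t - r j) (fun j => r j ^ 2) = -24 * (r 0 * r 1 * r 2 * r 3) := by
  unfold q24 P1uup Puuuu P11pp
  ring

/-- uncharged cells: with all `n_j = 0`, `24·q = −2·Σ_{splits}(α_i−α_j)²(α_k−α_l)²` (so `q ≤ 0` over an ordered field, `= 0` iff
some split has equal letters on both sides — the connector cells `[x|hI³]`, `[aI³|x]`). -/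
theorem q_uncharged (α : Fin 4 → R) :
    q24 α (fun _ => 0) = -2 * ((α 0 - α 1) ^ 2 * (α 2 - α 3) ^ 2 + (α 0 - α 2) ^ 2 * (α 1 - α 3) ^ 2
      + (α 0 - α 3) ^ 2 * (α 1 - α 2) ^ 2) := by
  unfold q24 P1uup Puuuu P11pp
  ring

end Q

end Summit.HodgeConjecture.HodgeConjecture.Cruxes.BlochSeedDiscOne.DualLaw
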